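import Summits.QuantumFields.YangMills.Theorems.UnitScaleTiltProp7CoCurlOfCurvatureCommutator
import HarnessLib

/-!
# Route `UnitScaleTilt`, crux K1 «MinimiserStabilityRegPr» (stmt-QuantumFields-19200), route-R E′ growth side, R5 row (H) — «(H)-RED-2»: THE CURRENT CONJUGATION
# DEFECT `Σ_ν[R(P̆_ν)φ(x) − R(P_ν)φ(x)]` (the `φ`-undifferentiated part of `D*_W(curl_W D_Wφ)`, i.e. the «`[J, φ]`» object of the hJ ∕ hRes residue in its
# CONJUGATION-DIFFERENCE letter) IS BOOKABLE IN THE CURVATURE-COMMUTATOR CURRENCY: pointwise `≤ |D*_W(curl_W D_Wφ)| + 2a·(covariant differences)`, and summed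
# `Σ_{x,μ}‖·‖² ≤ 6·Σ_{x,μ,ν}‖(curl_W D_Wφ)(p_{νμ}(x))‖² + 972·|ι|·a²·Σ_{x,κ}‖D_{W,κ}φ(x)‖²` — NO absolute value of `φ`

Cell `ym3-torus`, width seat `ym-ust-19200-w4` (gen 7), line HKGK-ANALYTIC; ★p1 g16 NAMER WORD 7 (2026-08-28 23:49Z, «(H)-REDUCTION»: `hRes ⟸ hKg-K + hJ`) and this seat's
located remark (bus 2026-08-29 00:0xZ): hJ's object, AS PRODUCED by `Δ_WΨ` = differences of adjacent ladder holonomies, is a CONJUGATION DIFFERENCE, and that letter is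
bounded by the co-curl of the curvature commutator EXACTLY (✓ `Prop7CoCurlOfCurvatureCommutator.covDstar_curl_covD_eq`), whereas the commutator letter `[J, φ]` costs the
second-order term `8|ι|a²‖φ‖` of ✓ `norm_sum_R_sub_R_le` — an absolute potential, dead currency.  THEOREMS ONLY (0 `def`, 0 `sorry`); `--supports stmt-QuantumFields-19200`,
count-neutral.  YM₃ on T³ is a ladder rung (R3), not the Clay problem; nothing here claims hJ, (H), S3, E′, a stub, the crux, d = 4 or the mass gap.

WHAT IS PROVED (ns `…Theorems.Prop7CurrentConjugationDefect`; abstract calculus of `B9Eq39Adjoint`: sites `S`, commuting shifts `T : ι → Equiv.Perm S`, units `U : ι → S → 𝔸ˣ`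
of norm `≤ 1` with inverses of norm `≤ 1`, plaquettes within `a ≥ 0` of `1`).
* §1 ★★ `norm_conjDefect_le` — POINTWISE: `‖R(P̆_ν)φ(x) − R(P_ν)φ(x)‖ ≤ ‖(curl D φ)_{νμ}(x − e_ν)‖ + ‖(curl D φ)_{νμ}(x)‖ + 2a·(five covariant differences)` (T2's exact
  decomposition read backwards + ✓ `norm_covDstar_le`).
* §2 ★★★ `sum_norm_sq_conjDefect_le` — SUMMED over a finite torus (`Fintype S`, shift-invariant sums): for every `μ ν`,
  `Σ_x‖R(P̆_ν)φ(x) − R(P_ν)φ(x)‖² ≤ 6·Σ_x‖(curl D φ)_{νμ}(x)‖² + 108·a²·(5·Σ_x‖D_νφ(x)‖² + 4·Σ_x‖D_μφ(x)‖²)` — the «J-part» of the hRes∕hJ residue in the currencies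
  (Kg) = `K_gauge` and (eM) (`a² = e²ℓ⁻⁴`), with NO `‖φ(x)‖` anywhere.  (Consumers sum over `μ, ν` and transport∕average as their local-model letters require; the
  telescoped transport differences are again covariant differences of `φ`.)
HONEST SCOPE.  Triangle inequalities over one landed identity; the dictionary to the R5∕(H) local-model letters (`Ψ^h_y`, ladders, `N(y)`) is the consumer's; nothing of hJ,
(H), S3 or the crux is claimed.

References: T. Bałaban, CMP 99 (1985) 389–434 [Balaban1985BackgroundPropagators] ((3.4) p.391, (3.8)–(3.9) p.392); CMP 99 (1985) 75–102 [Balaban1985RegularSpaces]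
((1.1)–(1.2) p.76, (1.9) p.77); CMP 102 (1985) 277–309 [Balaban1985Variational] ((2) p.278, Prop. 7 p.299).
-/

set_option autoImplicit false

noncomputable section

namespace Summit.QuantumFields.YangMills.Theorems.Prop7CurrentConjugationDefect

open Literature.MathematicalPhysics.QuantumFieldTheory.Balaban1983to89
open B9Eq39Adjoint (R covD covDstar curl plaqU)
open Summit.QuantumFields.YangMills.Theorems.Prop7CoCurlOfCurvatureCommutator (norm_covDstar_curl_covD_sub_le norm_covDstar_le)

variable {𝔸 : Type*} [NormedRing 𝔸] {S : Type*} {ι : Type*} (T : ι → Equiv.Perm S) (U : ι → S → 𝔸ˣ)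

/-! ## §1 Pointwise -/

/-- ★★ **THE CURRENT CONJUGATION DEFECT, POINTWISE**: with `P_ν = U(∂p_{νμ}(x))`, `P̆_ν` the plaquette at `x − e_ν` transported to `x`,
`‖R(P̆_ν)φ(x) − R(P_ν)φ(x)‖ ≤ ‖(D_UD_Uφ)(p_{νμ}(x−e_ν))‖ + ‖(D_UD_Uφ)(p_{νμ}(x))‖ + 2a·(‖D_νφ(x′)‖ + 3‖D_νφ(x+e_μ)‖ + 3‖D_μφ(x)‖ + ‖D_νφ(x′+e_μ)‖ + ‖D_μφ(x′)‖)`,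
`x′ = x − e_ν` — the undifferentiated-`φ` term of the co-curl is controlled by the curvature commutator and covariant differences, never by `‖φ‖`.
[cite: Balaban1985BackgroundPropagators, (3.4) p.391, (3.8)-(3.9) p.392; Balaban1985RegularSpaces, (1.9) p.77] -/
theorem norm_conjDefect_le (hT : ∀ (μ ν : ι) (y : S), T μ (T ν y) = T ν (T μ y))
    (hU : ∀ (κ : ι) (y : S), ‖(U κ y : 𝔸)‖ ≤ 1 ∧ ‖(((U κ y)⁻¹ : 𝔸ˣ) : 𝔸)‖ ≤ 1)
    {a : ℝ} (ha : 0 ≤ a) (hplaq : ∀ (μ ν : ι) (y : S), ‖(plaqU T U μ ν y : 𝔸) - 1‖ ≤ a)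
    (φ : S → 𝔸) (μ ν : ι) (x : S) :
    ‖R ((U ν ((T ν).symm x))⁻¹ * plaqU T U ν μ ((T ν).symm x) * U ν ((T ν).symm x)) (φ x) - R (plaqU T U ν μ x) (φ x)‖
      ≤ ‖curl T U (fun κ => covD T U κ φ) ν μ ((T ν).symm x)‖ + ‖curl T U (fun κ => covD T U κ φ) ν μ x‖
        + 2 * a * (‖covD T U ν φ ((T ν).symm x)‖ + 3 * ‖covD T U ν φ (T μ x)‖ + 3 * ‖covD T U μ φ x‖
          + ‖covD T U ν φ (T μ ((T ν).symm x))‖ + ‖covD T U μ φ ((T ν).symm x)‖) := by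
  set M : 𝔸 := R ((U ν ((T ν).symm x))⁻¹ * plaqU T U ν μ ((T ν).symm x) * U ν ((T ν).symm x)) (φ x) - R (plaqU T U ν μ x) (φ x) with hM
  set Dq : 𝔸 := covDstar T U ν (curl T U (fun κ => covD T U κ φ) ν μ) x with hDq
  have hrem := norm_covDstar_curl_covD_sub_le T U hT hU ha hplaq φ μ ν x
  rw [← hDq, ← hM] at hrem
  have h1 : ‖M‖ ≤ ‖Dq‖ + ‖Dq - M‖ := by
    have e : M = Dq - (Dq - M) := by abel
    calc ‖M‖ = ‖Dq - (Dq - M)‖ := by rw [← e]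
      _ ≤ ‖Dq‖ + ‖Dq - M‖ := norm_sub_le _ _
  have h2 : ‖Dq‖ ≤ ‖curl T U (fun κ => covD T U κ φ) ν μ ((T ν).symm x)‖ + ‖curl T U (fun κ => covD T U κ φ) ν μ x‖ := by
    rw [hDq]; exact norm_covDstar_le T U hU _ ν x
  linarith

/-! ## §2 Summed over a finite torus -/

variable [Fintype S]

omit [Fintype S] in
/-- Cauchy–Schwarz for the five-term remainder with weights `1,3,3,1,1`: `(b₁ + 3b₂ + 3b₃ + b₄ + b₅)² ≤ 9·(b₁² + 3b₂² + 3b₃² + b₄² + b₅²)`. [folklore] -/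
theorem sq_five_le (b₁ b₂ b₃ b₄ b₅ : ℝ) :
    (b₁ + 3 * b₂ + 3 * b₃ + b₄ + b₅) ^ 2 ≤ 9 * (b₁ ^ 2 + 3 * b₂ ^ 2 + 3 * b₃ ^ 2 + b₄ ^ 2 + b₅ ^ 2) := by
  nlinarith [sq_nonneg (b₁ - b₂), sq_nonneg (b₁ - b₃), sq_nonneg (b₁ - b₄), sq_nonneg (b₁ - b₅), sq_nonneg (b₂ - b₃), sq_nonneg (b₂ - b₄),
    sq_nonneg (b₂ - b₅), sq_nonneg (b₃ - b₄), sq_nonneg (b₃ - b₅), sq_nonneg (b₄ - b₅)]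

omit [Fintype S] in
/-- Shift invariance of torus sums: `Σ_x g((T ν)⁻¹ x) = Σ_x g(x)` and `Σ_x g(T μ x) = Σ_x g(x)`. [folklore] -/
theorem sum_comp_perm [Fintype S] (e : Equiv.Perm S) (g : S → ℝ) : ∑ x, g (e x) = ∑ x, g x :=
  Equiv.sum_comp e g

/-- ★★★ **THE CURRENT CONJUGATION DEFECT, SUMMED — BOOKED IN (Kg) + (eM)**: on a finite torus with commuting shifts, bond units of norm `≤ 1` with inverses of norm `≤ 1`, and
plaquettes within `a ≥ 0` of `1`, for every `φ` and every pair of directions `μ ν`: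
`Σ_x‖R(P̆_ν)φ(x) − R(P_ν)φ(x)‖² ≤ 6·Σ_x‖(D_UD_Uφ)(p_{νμ}(x))‖² + 108·a²·(5·Σ_x‖D_νφ(x)‖² + 4·Σ_x‖D_μφ(x)‖²)` — the «`[J, φ]`»-type residue of hRes∕hJ in its
conjugation-difference letter is controlled by the curvature commutator `K_gauge`-integrand and by `a²`× covariant differences; NO `‖φ(x)‖` appears.
[cite: Balaban1985BackgroundPropagators, (3.4) p.391, (3.8)-(3.9) p.392; Balaban1985RegularSpaces, (1.1)-(1.2) p.76, (1.9) p.77; Balaban1985Variational, (2) p.278, Prop. 7 p.299] -/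
theorem sum_norm_sq_conjDefect_le (hT : ∀ (μ ν : ι) (y : S), T μ (T ν y) = T ν (T μ y))
    (hU : ∀ (κ : ι) (y : S), ‖(U κ y : 𝔸)‖ ≤ 1 ∧ ‖(((U κ y)⁻¹ : 𝔸ˣ) : 𝔸)‖ ≤ 1)
    {a : ℝ} (ha : 0 ≤ a) (hplaq : ∀ (μ ν : ι) (y : S), ‖(plaqU T U μ ν y : 𝔸) - 1‖ ≤ a)
    (φ : S → 𝔸) (μ ν : ι) :
    ∑ x, ‖R ((U ν ((T ν).symm x))⁻¹ * plaqU T U ν μ ((T ν).symm x) * U ν ((T ν).symm x)) (φ x) - R (plaqU T U ν μ x) (φ x)‖ ^ 2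
      ≤ 6 * ∑ x, ‖curl T U (fun κ => covD T U κ φ) ν μ x‖ ^ 2
        + 108 * a ^ 2 * (5 * ∑ x, ‖covD T U ν φ x‖ ^ 2 + 4 * ∑ x, ‖covD T U μ φ x‖ ^ 2) := by
  -- notation for the pieces
  set G : S → ℝ := fun y => ‖curl T U (fun κ => covD T U κ φ) ν μ y‖ with hG
  set Dν : S → ℝ := fun y => ‖covD T U ν φ y‖ with hDν
  set Dμ : S → ℝ := fun y => ‖covD T U μ φ y‖ with hDμ
  -- pointwise square bound
  have hpt : ∀ x, ‖R ((U ν ((T ν).symm x))⁻¹ * plaqU T U ν μ ((T ν).symm x) * U ν ((T ν).symm x)) (φ x) - R (plaqU T U ν μ x) (φ x)‖ ^ 2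
      ≤ 3 * (G ((T ν).symm x) ^ 2 + G x ^ 2)
        + 108 * a ^ 2 * (Dν ((T ν).symm x) ^ 2 + 3 * Dν (T μ x) ^ 2 + 3 * Dμ x ^ 2 + Dν (T μ ((T ν).symm x)) ^ 2 + Dμ ((T ν).symm x) ^ 2) := by
    intro x
    have h := norm_conjDefect_le T U hT hU ha hplaq φ μ ν x
    set m := ‖R ((U ν ((T ν).symm x))⁻¹ * plaqU T U ν μ ((T ν).symm x) * U ν ((T ν).symm x)) (φ x) - R (plaqU T U ν μ x) (φ x)‖ with hm
    set f5 := Dν ((T ν).symm x) + 3 * Dν (T μ x) + 3 * Dμ x + Dν (T μ ((T ν).symm x)) + Dμ ((T ν).symm x) with hf5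
    have h' : m ≤ G ((T ν).symm x) + G x + 2 * a * f5 := by simpa [hG, hDν, hDμ, hf5] using h
    have hm0 : 0 ≤ m := norm_nonneg _
    have hrhs0 : 0 ≤ G ((T ν).symm x) + G x + 2 * a * f5 := hm0.trans h'
    have hsq : m ^ 2 ≤ (G ((T ν).symm x) + G x + 2 * a * f5) ^ 2 := pow_le_pow_left₀ hm0 h' 2
    have h3 : (G ((T ν).symm x) + G x + 2 * a * f5) ^ 2 ≤ 3 * (G ((T ν).symm x) ^ 2 + G x ^ 2 + (2 * a * f5) ^ 2) := by
      nlinarith [sq_nonneg (G ((T ν).symm x) - G x), sq_nonneg (G x - 2 * a * f5), sq_nonneg (G ((T ν).symm x) - 2 * a * f5)]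
    have h5 := sq_five_le (Dν ((T ν).symm x)) (Dν (T μ x)) (Dμ x) (Dν (T μ ((T ν).symm x))) (Dμ ((T ν).symm x))
    have e5 : (2 * a * f5) ^ 2 = 4 * a ^ 2 * f5 ^ 2 := by ring
    rw [← hf5] at h5
    nlinarith [h5, sq_nonneg a]
  -- sum and use shift invariance
  have hsum := Finset.sum_le_sum fun x (_ : x ∈ Finset.univ) => hpt x
  refine hsum.trans (le_of_eq ?_)
  have s1 : ∑ x, G ((T ν).symm x) ^ 2 = ∑ x, G x ^ 2 := sum_comp_perm (T ν).symm (fun y => G y ^ 2)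
  have s2 : ∑ x, Dν ((T ν).symm x) ^ 2 = ∑ x, Dν x ^ 2 := sum_comp_perm (T ν).symm (fun y => Dν y ^ 2)
  have s3 : ∑ x, Dν (T μ x) ^ 2 = ∑ x, Dν x ^ 2 := sum_comp_perm (T μ) (fun y => Dν y ^ 2)
  have s4 : ∑ x, Dν (T μ ((T ν).symm x)) ^ 2 = ∑ x, Dν x ^ 2 := by
    rw [sum_comp_perm (T ν).symm (fun y => Dν (T μ y) ^ 2)]; exact s3
  have s5 : ∑ x, Dμ ((T ν).symm x) ^ 2 = ∑ x, Dμ x ^ 2 := sum_comp_perm (T ν).symm (fun y => Dμ y ^ 2)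
  have eG : ∑ x, 3 * (G ((T ν).symm x) ^ 2 + G x ^ 2) = 6 * ∑ x, G x ^ 2 := by
    rw [← Finset.mul_sum, Finset.sum_add_distrib, s1]; ring
  have eD : ∑ x, 108 * a ^ 2 * (Dν ((T ν).symm x) ^ 2 + 3 * Dν (T μ x) ^ 2 + 3 * Dμ x ^ 2 + Dν (T μ ((T ν).symm x)) ^ 2 + Dμ ((T ν).symm x) ^ 2)
      = 108 * a ^ 2 * (5 * ∑ x, Dν x ^ 2 + 4 * ∑ x, Dμ x ^ 2) := by
    rw [← Finset.mul_sum]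
    congr 1
    simp only [Finset.sum_add_distrib, ← Finset.mul_sum, s2, s3, s4, s5]
    ring
  rw [Finset.sum_add_distrib, eG, eD]

end Summit.QuantumFields.YangMills.Theorems.Prop7CurrentConjugationDefect

end
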